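import Literature.Analysis.FluidPDE.DissipativeEulerReynolds
import Literature.Analysis.FluidPDE.FractionalNSStartingTriple
import HarnessLib

/-!
# De Lellis–Kwon 2022, §2.3: the starting tuple of the iteration is a dissipative
# Euler–Reynolds flow with a nontrivial energy loss

Proofs file on the discharge path of the named fact `Torus.DeLellisKwon2022_thm11`
(`GloballyDissipativeEuler`; C. De Lellis, H. Kwon, Anal. PDE 15 (2022) = arXiv:2006.06482,
Thm. 1.1). In §2.3 ("Proof of Theorem 1.1") the iteration of Prop. 2.3 is started from the
explicit tuple

> `p₀ = κ₀ = 0`, `v₀ = (1 - 2δ₀^{1/2} + E(t))^{1/2} (cos λ̄x₃, sin λ̄x₃, 0)`, `φ₀ = 0`,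
> `R₀ := λ̄⁻¹ (d/dt)(1 - 2δ₀^{1/2} + E(t))^{1/2} [[0,0,sin λ̄x₃],[0,0,-cos λ̄x₃],[sin λ̄x₃,-cos λ̄x₃,0]]`,
> "it is easy to check that the tuple satisfies (2.1), (2.5), and (2.8)"

where (2.1) is the dissipative Euler–Reynolds system of Def. 2.1 with energy loss `E`
(`Torus.IsDissipativeEulerReynoldsOn`, `DissipativeEulerReynolds`). This file proves "(2.1) is
easy to check" on the tree's unit torus `𝕋³ = (ℝ/ℤ)³`, for an ARBITRARY smooth amplitude `g`
with `(g²)' = E'` and integer frequency `n ≥ 1` (frequency `2πn` in place of the printed integer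
`λ̄` on `[-π,π]³`), reusing the shear mode and stress profile of the identical ansatz of
Colombo–De Lellis–De Rosa 2018, Lemma 3.1 (`CDLDR.shearVelocity n g = g(t) P_n`,
`P_n(y) = (sin 2πn y₁, 0, cos 2πn y₁)`; `CDLDR.stressProfile n = S_n` with `div S_n = 2πn P_n`,
`FractionalNSStartingTriple` — the printed `(cos λ̄x₃, sin λ̄x₃, 0)` up to relabelling the axes):

* `DLK.startStress n g t = (g'(t)/(2πn)) S_n` — the printed `R₀` (no viscous part, unlike
  `CDLDR.shearStress`), symmetric and trace free, with `div R₀ = g' P_n = ∂ₜ v₀`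
  (`DLK.tensorDivergence_startStress`), `(v₀·∇)R₀ = 0` and `R₀ v₀ = 0`
  (`DLK.sum_shearVelocity_smul_startStress`: the polarisations satisfy `S_n P_n = 0`);
* `DLK.isDissipativeEulerReynoldsOn_start` — **(2.1) for the starting tuple**: for `g` smooth on an
  open `V ⊇ S` with `2 g g' = E'` on `S` and `E` smooth, `(v₀, 0, R₀, 0, 0)` is a dissipative
  Euler–Reynolds flow on `S × 𝕋³` with energy loss `E`: the momentum equation is
  `g'P_n + 0 + 0 = div R₀`, and the relaxed local energy equality reduces to
  `∂ₜ(½|v₀|²) = ½(g²)' = E'/2`, all other terms vanishing (`|v₀|² = g²` is constant in space,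
  `div v₀ = 0`, `κ₀ = 0`, `R₀v₀ = 0`, `φ₀ = 0`);
* `DLK.isDissipativeEulerReynoldsOn_start_sqrt` — the printed amplitude
  `g = (c + E)^{1/2}` (`c = 1 - 2δ₀^{1/2}`), on all of `ℝ` when `c + E > 0`;
* the pointwise sizes entering (2.4)–(2.7) at `q = 0`: `‖v₀‖ = |g|`, `‖R₀‖ ≤ √2 |g'|/(2πn)`,
  `‖∂ᵢR₀‖ ≤ √2 |g'|`, `‖∂ₜR₀ + (v₀·∇)R₀‖ ≤ √2 |g''|/(2πn)` (the parameter inequalities of §2.3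
  turning these into (2.4)–(2.7) belong with the iteration, not here).

## References

* C. De Lellis, H. Kwon, *On nonuniqueness of Hölder continuous globally dissipative Euler
  flows*, Anal. PDE 15 (2022) 2003–2059 = arXiv:2006.06482, Def. 2.1, §2.3 (proof of Thm. 1.1:
  the starting tuple). [DelellisKwon2022]
* M. Colombo, C. De Lellis, L. De Rosa, Comm. Math. Phys. 362 (2018) = arXiv:1708.05666, §3.1
  Lemma 3.1 (the same shear-flow ansatz). [ColomboDelellisDerosa2018]
-/

noncomputable section

open MeasureTheory Set Filter Function UnitAddTorus
open scoped ENNReal NNReal InnerProductSpace RealInnerProductSpace ContDiff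

namespace Literature.Analysis.FluidPDE

namespace DLK

open FunctionSpaces FunctionSpaces.Torus PulsedShear CDLDR

/-- The flat three-torus `𝕋³ = (ℝ/ℤ)³`, local notation. -/
local notation "𝕋³" => UnitAddTorus (Fin 3)

/-- Euclidean `ℝ³`, local notation. -/
local notation "ℝ³" => EuclideanSpace ℝ (Fin 3)

variable {n : ℕ} {g : ℝ → ℝ} {V S : Set ℝ}

/-! ## The starting stress `R₀ = (g'/(2πn)) S_n` -/

/-- **The starting Reynolds stress of DLK §2.3**: `R₀(t) = (g'(t)/(2πn)) S_n`, the printed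
`λ̄⁻¹ (d/dt)(1-2δ₀^{1/2}+E)^{1/2} [[0,0,sin],[0,0,-cos],[sin,-cos,0]](λ̄x₃)` with `g` the
amplitude of `v₀ = g P_n` and `S_n = CDLDR.stressProfile n` (axes relabelled as in
`FractionalNSStartingTriple`). [cite: DelellisKwon2022, §2.3 (definition of R₀)] -/
def startStress (n : ℕ) (g : ℝ → ℝ) : ℝ → 𝕋³ → Fin 3 → ℝ³ :=
  fun t => (deriv g t / (2 * Real.pi * n)) • stressProfile n

/-- Unfolding the starting stress. [folklore] -/
@[simp] theorem startStress_apply (n : ℕ) (g : ℝ → ℝ) (t : ℝ) (y : 𝕋³) :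
    startStress n g t y = (deriv g t / (2 * Real.pi * n)) • stressProfile n y := rfl

/-- The starting stress is symmetric. [folklore] -/
theorem startStress_symm (n : ℕ) (g : ℝ → ℝ) (t : ℝ) (y : 𝕋³) (i j : Fin 3) :
    startStress n g t y i j = startStress n g t y j i := by
  rw [startStress_apply, Pi.smul_apply, Pi.smul_apply, PiLp.smul_apply, PiLp.smul_apply,
    stressProfile_symm]

/-- The starting stress is trace free: its diagonal entries vanish. [folklore] -/
theorem startStress_diag (n : ℕ) (g : ℝ → ℝ) (t : ℝ) (y : 𝕋³) (i : Fin 3) :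
    startStress n g t y i i = 0 := by
  rw [startStress_apply, Pi.smul_apply, PiLp.smul_apply, stressProfile_diag, smul_zero]

/-- `‖R₀(t,y)‖ ≤ √2 |g'(t)|/(2πn)` (columnwise sup norm; `‖S_n‖ ≤ √2`). [folklore] -/
theorem norm_startStress_le (n : ℕ) (g : ℝ → ℝ) (t : ℝ) (y : 𝕋³) :
    ‖startStress n g t y‖ ≤ Real.sqrt 2 * (|deriv g t| / (2 * Real.pi * n)) := by
  rw [startStress_apply, norm_smul, Real.norm_eq_abs, abs_div, mul_comm]
  have h2 : |2 * Real.pi * (n : ℝ)| = 2 * Real.pi * n := abs_of_nonneg (by positivity)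
  rw [h2]
  exact mul_le_mul_of_nonneg_right (norm_stressProfile_le n y) (by positivity)

/-- `‖∂ᵢ R₀(t,y)‖ ≤ √2 |g'(t)|` for `n ≥ 1` (`‖∂ᵢ S_n‖ ≤ 2πn √2`). [folklore] -/
theorem norm_partialDeriv_startStress_le (hn : 1 ≤ n) (g : ℝ → ℝ) (i : Fin 3) (t : ℝ) (y : 𝕋³) :
    ‖FunctionSpaces.Torus.partialDeriv i (startStress n g t) y‖ ≤ Real.sqrt 2 * |deriv g t| := by
  have hpos : 0 < 2 * Real.pi * (n : ℝ) := by
    have : (1 : ℝ) ≤ n := by exact_mod_cast hn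
    positivity
  rw [startStress, partialDeriv_const_smul (isContDiff_stressProfile n), Pi.smul_apply, norm_smul,
    Real.norm_eq_abs, abs_div, abs_of_pos hpos]
  calc |deriv g t| / (2 * Real.pi * n) * ‖FunctionSpaces.Torus.partialDeriv i (stressProfile n) y‖
      ≤ |deriv g t| / (2 * Real.pi * n) * (2 * Real.pi * n * Real.sqrt 2) :=
        mul_le_mul_of_nonneg_left (norm_partialDeriv_stressProfile_le n i y) (by positivity)
    _ = Real.sqrt 2 * |deriv g t| := by
        field_simp

/-- **`div R₀ = g' P_n`** (`= ∂ₜ v₀`): the starting stress balances the time derivative of the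
starting velocity in the momentum equation (`div S_n = 2πn P_n`). [cite: DelellisKwon2022, §2.3 ("the tuple satisfies (2.1)")] -/
theorem tensorDivergence_startStress (hn : 1 ≤ n) (g : ℝ → ℝ) (t : ℝ) (y : 𝕋³) :
    Torus.tensorDivergence (startStress n g t) y = deriv g t • profile n y := by
  have hpos : 0 < 2 * Real.pi * (n : ℝ) := by
    have : (1 : ℝ) ≤ n := by exact_mod_cast hn
    positivity
  rw [startStress, Torus.tensorDivergence_const_smul (isContDiff_stressProfile n),
    tensorDivergence_stressProfile, smul_smul, div_mul_cancel₀ _ hpos.ne']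

/-- The starting stress depends on `y₁` only while `v₀ ∥ (·, 0, ·)`: `(v₀·∇)R₀ = 0`. [folklore] -/
theorem convect_startStress (n : ℕ) (g : ℝ → ℝ) (t : ℝ) (y : 𝕋³) :
    FunctionSpaces.Torus.convect (shearVelocity n g t) (startStress n g t) y = 0 := by
  have h1 : IsContDiff 1 (startStress n g t) := (isContDiff_stressProfile n).smul _
  unfold FunctionSpaces.Torus.convect
  rw [fderiv_apply_eq_sum_partialDeriv h1]
  refine Finset.sum_eq_zero fun i _ => ?_
  by_cases hi : i = 1
  · subst hi
    simp [profile_apply_one]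
  · rw [startStress, partialDeriv_const_smul (isContDiff_stressProfile n), Pi.smul_apply,
      partialDeriv_stressProfile_of_ne_one n hi, smul_zero, smul_zero]

/-- **`S_n P_n = 0`**: `∑ⱼ (P_n)ⱼ S_n eⱼ = 0` pointwise — with `e = e^{2πiny₁}`,
`P_n = (Im e, 0, Re e)` and the columns `(0,-Re e,0)`, `(-Re e,0,Im e)`, `(0,Im e,0)` of `S_n`,
the only nonzero component is `-Im e Re e + Re e Im e = 0`. Hence the flux `R₀ v₀` of the relaxed
local energy equality vanishes for the starting tuple. [folklore] -/
theorem sum_profile_smul_stressProfile (n : ℕ) (y : 𝕋³) :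
    ∑ j, profile n y j • stressProfile n y j = 0 := by
  ext i
  rw [WithLp.ofLp_sum, Finset.sum_apply, Fin.sum_univ_three]
  simp only [WithLp.ofLp_smul, Pi.smul_apply, smul_eq_mul]
  change profile n y 0 * stressProfile n y 0 i + profile n y 1 * stressProfile n y 1 i +
      profile n y 2 * stressProfile n y 2 i = (0 : ℝ³) i
  rw [profile_apply_zero, profile_apply_one, profile_apply_two, stressProfile_apply,
    stressProfile_apply, stressProfile_apply]
  fin_cases i <;> (simp; try ring)

/-- The flux `R₀ v₀ = ∑ⱼ (v₀)ⱼ R₀ eⱼ` of the starting tuple vanishes identically. [folklore] -/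
theorem sum_shearVelocity_smul_startStress (n : ℕ) (g : ℝ → ℝ) (t : ℝ) (y : 𝕋³) :
    ∑ j, shearVelocity n g t y j • startStress n g t y j = 0 := by
  have h : ∀ j, shearVelocity n g t y j • startStress n g t y j =
      (g t * (deriv g t / (2 * Real.pi * n))) • (profile n y j • stressProfile n y j) := fun j => by
    rw [shearVelocity_apply, startStress_apply, PiLp.smul_apply, Pi.smul_apply, smul_eq_mul,
      smul_smul, smul_smul]
    congr 1
    ring
  simp_rw [h, ← Finset.smul_sum, sum_profile_smul_stressProfile, smul_zero]

/-- The coefficient `g'/(2πn)` of the starting stress is smooth where `g` is (open set). [folklore] -/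
theorem contDiffOn_startCoef (n : ℕ) (hV : IsOpen V) (hg : ContDiffOn ℝ ∞ g V) :
    ContDiffOn ℝ ∞ (fun t => deriv g t / (2 * Real.pi * n)) V :=
  (hg.deriv_of_isOpen hV le_rfl).div_const _

/-- The time derivative of the starting stress within `S ⊆ V`: `∂ₜR₀ = (g'/(2πn))' S_n`. [folklore] -/
theorem timeDerivWithin_startStress (hV : IsOpen V) (hSV : S ⊆ V) (hS : UniqueDiffOn ℝ S)
    (hg : ContDiffOn ℝ ∞ g V) {t : ℝ} (ht : t ∈ S) (y : 𝕋³) :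
    FunctionSpaces.Torus.timeDerivWithin S (startStress n g) t y =
      deriv (fun s => deriv g s / (2 * Real.pi * n)) t • stressProfile n y := by
  have hdiff : DifferentiableAt ℝ (fun s => deriv g s / (2 * Real.pi * n)) t :=
    ((contDiffOn_startCoef n hV hg).differentiableOn (by simp)).differentiableAt
      (hV.mem_nhds (hSV ht))
  have h : HasDerivWithinAt (fun τ => startStress n g τ y)
      (deriv (fun s => deriv g s / (2 * Real.pi * n)) t • stressProfile n y) S t :=
    (hdiff.hasDerivAt.smul_const (stressProfile n y)).hasDerivWithinAt
  exact h.derivWithin (hS t ht)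

/-- **The transport derivative of the starting stress**: `∂ₜR₀ + (v₀·∇)R₀ = (g''/(2πn)) S_n`,
hence `‖∂ₜR₀ + (v₀·∇)R₀‖ ≤ √2 |g''|/(2πn)` (DLK §2.3: "`‖D_t R₀‖_N = ‖∂ₜ R₀‖_N ≤ C λ̄^{N-1}(‖E''‖₀ + ‖E'‖₀²)`").
[cite: DelellisKwon2022, §2.3 (estimate of D_t R₀)] -/
theorem norm_transport_startStress_le (hV : IsOpen V) (hSV : S ⊆ V) (hS : UniqueDiffOn ℝ S)
    (hg : ContDiffOn ℝ ∞ g V) {t : ℝ} (ht : t ∈ S) (y : 𝕋³) :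
    ‖FunctionSpaces.Torus.timeDerivWithin S (startStress n g) t y +
        FunctionSpaces.Torus.convect (shearVelocity n g t) (startStress n g t) y‖ ≤
      Real.sqrt 2 * (|deriv (deriv g) t| / (2 * Real.pi * n)) := by
  have hd : deriv (fun s => deriv g s / (2 * Real.pi * n)) t = deriv (deriv g) t / (2 * Real.pi * n) := by
    simp only [div_eq_mul_inv]
    exact deriv_mul_const_field _
  rw [timeDerivWithin_startStress hV hSV hS hg ht, convect_startStress, add_zero, norm_smul, hd,
    Real.norm_eq_abs, abs_div, mul_comm]
  have h2 : |2 * Real.pi * (n : ℝ)| = 2 * Real.pi * n := abs_of_nonneg (by positivity)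
  rw [h2]
  exact mul_le_mul_of_nonneg_right (norm_stressProfile_le n y) (by positivity)

/-! ## The starting tuple is a dissipative Euler–Reynolds flow -/

/-- The kinetic energy density of the starting velocity is `½ g(t)²`, constant in space. [folklore] -/
theorem energyDensity_shearVelocity (n : ℕ) (g : ℝ → ℝ) (s : ℝ) (y : 𝕋³) :
    2⁻¹ * ‖shearVelocity n g s y‖ ^ 2 = 2⁻¹ * g s ^ 2 := by
  rw [norm_shearVelocity, sq_abs]

/-- The energy flux field `(½|v₀|² + 0) v₀` of the starting tuple is the shear flow with
amplitude `½g³`. [folklore] -/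
theorem energyFlux_shearVelocity_eq (n : ℕ) (g : ℝ → ℝ) (t : ℝ) :
    (fun y => (2⁻¹ * ‖shearVelocity n g t y‖ ^ 2 + (fun (_ : ℝ) (_ : 𝕋³) => (0 : ℝ)) t y) •
        shearVelocity n g t y) =
      shearVelocity n (fun s => 2⁻¹ * g s ^ 2 * g s) t := by
  funext y
  rw [energyDensity_shearVelocity, add_zero, shearVelocity_apply, shearVelocity_apply, smul_smul]

/-- **De Lellis–Kwon 2022, §2.3: the starting tuple solves the dissipative Euler–Reynolds
system (2.1)** ("it is easy to check that the tuple satisfies (2.1)"). Let `n ≥ 1`, let `g` be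
smooth on an open set of times `V ⊇ S` (`S` a set of unique differentiability, e.g. `[0,T] + τ`
or `ℝ`), let `E : ℝ → ℝ` be smooth with `2 g g' = E'` on `S` (i.e. `g² = c + E` there). Then
`(v₀, p₀, R₀, κ₀, φ₀) = (g P_n, 0, (g'/(2πn)) S_n, 0, 0)` is a dissipative Euler–Reynolds flow on
`S × 𝕋³` with energy loss `E` (`Torus.IsDissipativeEulerReynoldsOn`): `∂ₜv₀ = g'P_n = div R₀`,
`(v₀·∇)v₀ = 0`, `div v₀ = 0`, `R₀` symmetric with `½ tr R₀ = 0 = κ₀`, and the relaxed local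
energy equality holds as `∂ₜ(½g²) + 0 = 0 + 0 + E'/2 + div(R₀v₀) + 0` with `R₀ v₀ = 0`.
[cite: DelellisKwon2022, §2.3 (proof of Thm. 1.1, starting tuple)] -/
theorem isDissipativeEulerReynoldsOn_start (hn : 1 ≤ n) (hV : IsOpen V) (hSV : S ⊆ V)
    (hS : UniqueDiffOn ℝ S) (hg : ContDiffOn ℝ ∞ g V) {E : ℝ → ℝ} (hE : ContDiff ℝ ∞ E)
    (hgE : ∀ t ∈ S, 2 * (g t * deriv g t) = deriv E t) :
    Torus.IsDissipativeEulerReynoldsOn S (shearVelocity n g) (fun _ _ => 0) (startStress n g)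
      (fun _ _ => 0) (fun _ _ => 0) E where
  smooth_velocity := (contDiffOn_stLift_smul_profile hg n).mono (prod_mono hSV subset_rfl)
  smooth_pressure := contDiffOn_const
  smooth_stress := (contDiffOn_stLift_smul_stressProfile (contDiffOn_startCoef n hV hg) n).mono
    (prod_mono hSV subset_rfl)
  smooth_kappa := contDiffOn_const
  smooth_current := contDiffOn_const
  smooth_energyLoss := hE
  momentum t ht y := by
    rw [timeDerivWithin_shearVelocity hV hSV hS hg ht, convect_shearVelocity, Torus.gradient_zero,
      tensorDivergence_startStress hn, add_zero, add_zero]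
  divFree t _ := isDivFree_shearVelocity n g t
  symm t _ y i j := startStress_symm n g t y i j
  kappa_eq t _ y := by
    simp [stressProfile_diag]
  localEnergy t ht y := by
    -- left-hand side: `∂ₜ(½ g²) = g g'` and `div((½g² + 0) v₀) = 0`
    have hdiff : DifferentiableAt ℝ g t :=
      (hg.differentiableOn (by simp)).differentiableAt (hV.mem_nhds (hSV ht))
    have h1 : FunctionSpaces.Torus.timeDerivWithin S (fun s y => 2⁻¹ * ‖shearVelocity n g s y‖ ^ 2) t y =
        g t * deriv g t := by
      unfold FunctionSpaces.Torus.timeDerivWithin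
      simp_rw [energyDensity_shearVelocity]
      have h : HasDerivWithinAt (fun s => 2⁻¹ * g s ^ 2) (2⁻¹ * (2 * g t * deriv g t)) S t := by
        have := (hdiff.hasDerivAt.pow 2).const_mul (2⁻¹ : ℝ)
        simpa using this.hasDerivWithinAt
      rw [h.derivWithin (hS t ht)]
      ring
    have h2 : FunctionSpaces.Torus.divergence
        (fun y => (2⁻¹ * ‖shearVelocity n g t y‖ ^ 2 + (fun (_ : ℝ) (_ : 𝕋³) => (0 : ℝ)) t y) •
          shearVelocity n g t y) y = 0 := by
      rw [energyFlux_shearVelocity_eq]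
      exact isDivFree_shearVelocity n _ t y
    -- right-hand side: only `E'/2` survives
    have h3 : (fun y => ∑ j, shearVelocity n g t y j • startStress n g t y j) =
        fun _ : 𝕋³ => (0 : ℝ³) := by
      funext y
      exact sum_shearVelocity_smul_startStress n g t y
    rw [h1, h2, h3, Torus.timeDerivWithin_zero, Torus.gradient_zero, inner_zero_right,
      Torus.divergence_zero]
    linarith [hgE t ht]

/-- Smoothness of the printed amplitude `(c + E)^{1/2}` where `c + E > 0`. [folklore] -/
theorem contDiffOn_sqrt_const_add {E : ℝ → ℝ} (hE : ContDiff ℝ ∞ E) {c : ℝ} {V : Set ℝ}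
    (hpos : ∀ t ∈ V, 0 < c + E t) :
    ContDiffOn ℝ ∞ (fun t => Real.sqrt (c + E t)) V := fun t ht =>
  ((contDiff_const.add hE).contDiffAt.sqrt (hpos t ht).ne').contDiffWithinAt

/-- The printed amplitude satisfies `2 g g' = E'` where `c + E > 0` (chain rule for
`g = (c + E)^{1/2}`, `g² = c + E`). [folklore] -/
theorem two_mul_sqrt_mul_deriv_sqrt {E : ℝ → ℝ} (hE : ContDiff ℝ ∞ E) {c t : ℝ}
    (hpos : 0 < c + E t) :
    2 * (Real.sqrt (c + E t) * deriv (fun s => Real.sqrt (c + E s)) t) = deriv E t := by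
  have hEd : HasDerivAt E (deriv E t) t :=
    ((hE.differentiable (by simp)) t).hasDerivAt
  have h : HasDerivAt (fun s => Real.sqrt (c + E s)) (deriv E t / (2 * Real.sqrt (c + E t))) t := by
    have := (hEd.const_add c).sqrt hpos.ne'
    simpa using this
  rw [h.deriv]
  have hs : 0 < Real.sqrt (c + E t) := Real.sqrt_pos.2 hpos
  field_simp

/-- **The printed starting tuple** (DLK §2.3 with `g = (c + E)^{1/2}`, `c = 1 - 2δ₀^{1/2}`): if
`E` is smooth and `c + E > 0` on `ℝ` (DLK (2.12): `1 - 2δ₀^{1/2} + E ≥ 1/2`), then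
`((c+E)^{1/2} P_n, 0, ((c+E)^{1/2})'/(2πn) S_n, 0, 0)` is a dissipative Euler–Reynolds flow with
energy loss `E` on the whole time axis (stage `q = 0` of the iteration lives on
`[0,T] + τ₋₁ = ℝ`). [cite: DelellisKwon2022, §2.3 (proof of Thm. 1.1, starting tuple)] -/
theorem isDissipativeEulerReynoldsOn_start_sqrt (hn : 1 ≤ n) {E : ℝ → ℝ} (hE : ContDiff ℝ ∞ E)
    {c : ℝ} (hpos : ∀ t, 0 < c + E t) :
    Torus.IsDissipativeEulerReynoldsOn univ (shearVelocity n fun t => Real.sqrt (c + E t))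
      (fun _ _ => 0) (startStress n fun t => Real.sqrt (c + E t)) (fun _ _ => 0) (fun _ _ => 0) E :=
  isDissipativeEulerReynoldsOn_start hn isOpen_univ subset_rfl uniqueDiffOn_univ
    (contDiffOn_sqrt_const_add hE fun t _ => hpos t) hE
    fun t _ => two_mul_sqrt_mul_deriv_sqrt hE (hpos t)

/-- The velocity of the printed starting tuple has the exact pointwise size
`‖v₀(t,y)‖ = (c + E(t))^{1/2}` and kinetic energy `½∫‖v₀(t)‖² = ½(c + E(t))`
(DLK §2.3: the total kinetic energy of the construction follows `E` up to a constant).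
[cite: DelellisKwon2022, §2.3] -/
theorem kineticEnergy_start_sqrt (n : ℕ) {E : ℝ → ℝ} {c : ℝ} (hpos : ∀ t, 0 < c + E t) (t : ℝ) :
    FunctionSpaces.Torus.kineticEnergy (shearVelocity n (fun t => Real.sqrt (c + E t)) t) =
      2⁻¹ * (c + E t) := by
  rw [FunctionSpaces.Torus.kineticEnergy, integral_norm_sq_shearVelocity,
    Real.sq_sqrt (hpos t).le]

end DLK

end Literature.Analysis.FluidPDE
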